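import Summits.ResolutionOfSingularities.ResolutionOfSingularities.Theorems.FrobeniusLadderFInjectiveMacaulayficationFullLastCentreTame
import HarnessLib

/-!
# K10i — THE TRANSLATION STEP (fibre points off the chart origin): `y_n ↦ y_n + c_n`, residual transport, slack inheritance, and the cap at translated drop points
# (crux `FInjectiveMacaulayfication` stmt-ResolutionOfSingularities-15315, chain w45a; closes the typed part of gap (g2) of desk ruling R26.40 for non-positive slacks;
# seat res-L1-w45a-lead-1 g16)

[OURS · L1 W4.5a] Support file (`--supports stmt-ResolutionOfSingularities-15315 --as helper`); replaces the role of NO printed item; NOT a statement of any manuscript;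
proves nothing of the crux; OURS counted 0. AI-written (AI review is weaker than expert review).

WHAT. The typed chains of K10e–K10g visit CHART ORIGINS only. A point of the current chart with letter coordinates `y = c` is reached by the TRANSLATION
`translate c : y_n ↦ y_n + c_n` (a `k`-algebra automorphism of `k[y]`); the exceptional letters with `c_n ≠ 0` no longer pass through the point and LEAVE `Exc`,
the defects of the surviving ones are unchanged (`IsTranslate`). The discriminant is transported by `translate c` (`disc_map`; any re-preparation `x ↦ x + t` leaves it
unchanged, `disc_xshift`). MAIN LEMMAS: (1) `isResidual_translate` — if `Disc = y^α·N` is the residual decomposition at the origin, then at `y = c` it is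
`y^{α|c=0}·(U·translate c N)` with `U = ∏_{c_m ≠ 0} (y_m + c_m)^{α_m}` a polynomial with non-zero constant term in the letters that left; the witness «`N` has a
monomial free of `y_n`» is transported through the substitution `y_m ↦ 0 (m ≠ kept)` (`keep`), which commutes with `translate c` exactly when `c` vanishes on the killed
letters. (2) `residual_unique` — the residual decomposition is unique. (3) ★ `allSlackLE_translate` / ★★ `translate_cap` — non-positive slacks are INHERITED by every
point of the chart (the exponents of the surviving letters and their defects do not change), hence (K10h) every translated point carrying the drop-point budget has
`ρ ≤ 8`. (4) Toolkit for K10j (the fibre no-rise law): `keep`, `coeff_keep`, `keep_translate`, `ordLE_unit_mul`, `totalDegree_translate_le`.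
Exponent/coefficient bookkeeping only; no named fact.
-/

-- single-problem summit: the doubled namespace component is forced
set_option linter.dupNamespace false

noncomputable section

open MvPolynomial Finsupp
open Summit.ResolutionOfSingularities.ResolutionOfSingularities.Theorems.FInjectiveMacaulayfication.LastCentreDefs
open Summit.ResolutionOfSingularities.ResolutionOfSingularities.Theorems.FInjectiveMacaulayfication.LastCentreAxisOrder
open Summit.ResolutionOfSingularities.ResolutionOfSingularities.Theorems.FInjectiveMacaulayfication.LastCentreSlack
open Summit.ResolutionOfSingularities.ResolutionOfSingularities.Theorems.FInjectiveMacaulayfication.LastCentreTame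

namespace Summit.ResolutionOfSingularities.ResolutionOfSingularities.Theorems.FInjectiveMacaulayfication.LastCentreTranslate

variable {k : Type} [Field k]

/-! ## 1. The translation automorphism -/

/-- TRANSLATION OF THE LETTERS `y_n ↦ y_n + c_n` (moving the origin of the chart to the point `y = c`). [OURS · L1 W4.5a · definition; folklore] -/
def translate (c : Letter → k) : YPoly k →ₐ[k] YPoly k :=
  aeval fun n => X n + C (c n)

/-- `translate c (y_n) = y_n + c_n`. [plumbing] -/
theorem translate_X (c : Letter → k) (n : Letter) : translate c (X n : YPoly k) = X n + C (c n) :=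
  aeval_X _ n

/-- `translate c` fixes constants. [plumbing] -/
theorem translate_C (c : Letter → k) (r : k) : translate c (C r : YPoly k) = C r := by
  unfold translate; rw [aeval_C, algebraMap_eq]

/-- `translate (−c)` undoes `translate c`. [plumbing] -/
theorem translate_neg_translate (c : Letter → k) (G : YPoly k) : translate (fun n => -c n) (translate c G) = G := by
  induction G using MvPolynomial.induction_on with
  | C a => rw [translate_C, translate_C]
  | add p q hp hq => rw [map_add, map_add, hp, hq]
  | mul_X p n hp => rw [map_mul, map_mul, hp, translate_X, map_add, translate_X, translate_C, C_neg]; ring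

/-- `translate c` is injective. [plumbing] -/
theorem translate_injective (c : Letter → k) : Function.Injective (translate (k := k) c) := fun a b h => by
  have := congrArg (translate (fun n => -c n)) h
  rwa [translate_neg_translate, translate_neg_translate] at this

/-- `translate c` of a monomial: `a·∏ (y_m + c_m)^{s_m}`. [plumbing] -/
theorem translate_monomial (c : Letter → k) (s : Expo) (a : k) :
    translate c (monomial s a) = C a * ∏ m ∈ s.support, (X m + C (c m)) ^ s m := by
  unfold translate; rw [aeval_monomial, algebraMap_eq, Finsupp.prod]

/-! ## 2. Killing letters: `keep T` (`y_m ↦ 0` for `m ∉ T`) -/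

/-- KEEP THE LETTERS IN `T`, KILL THE OTHERS: the substitution `y_m ↦ 0 (m ∉ T)`. [OURS · L1 W4.5a · definition; folklore] -/
def keep (T : Finset Letter) : YPoly k →ₐ[k] YPoly k :=
  aeval fun m => if m ∈ T then X m else 0

/-- `keep T (y_m)`. [plumbing] -/
theorem keep_X (T : Finset Letter) (m : Letter) : keep T (X m : YPoly k) = if m ∈ T then X m else 0 :=
  aeval_X _ m

/-- `keep T` fixes constants. [plumbing] -/
theorem keep_C (T : Finset Letter) (r : k) : keep T (C r : YPoly k) = C r := by
  unfold keep; rw [aeval_C, algebraMap_eq]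

/-- `keep T` of a monomial: itself if the monomial only involves letters of `T`, else `0`. [plumbing] -/
theorem keep_monomial (T : Finset Letter) (s : Expo) (a : k) :
    keep T (monomial s a) = if s.support ⊆ T then monomial s a else 0 := by
  classical
  unfold keep
  rw [aeval_monomial, algebraMap_eq, Finsupp.prod]
  split_ifs with h
  · rw [Finset.prod_congr rfl (fun i hi => by rw [if_pos (h hi)]), prod_X_pow_eq_monomial, C_mul_monomial, mul_one]
  · obtain ⟨i, hi, hiT⟩ := Finset.not_subset.mp h
    rw [Finset.prod_eq_zero hi (by rw [if_neg hiT, zero_pow (Finsupp.mem_support_iff.mp hi)]), mul_zero]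

/-- COEFFICIENTS OF `keep T G`: the monomials of `G` involving only letters of `T` survive, the others die. [OURS · L1 W4.5a] -/
theorem coeff_keep (T : Finset Letter) (G : YPoly k) (e : Expo) :
    coeff e (keep T G) = if e.support ⊆ T then coeff e G else 0 := by
  classical
  induction G using MvPolynomial.induction_on' with
  | monomial s a =>
    rw [keep_monomial]
    by_cases hs : s.support ⊆ T
    · rw [if_pos hs, coeff_monomial]
      by_cases hse : s = e
      · subst hse; rw [if_pos hs]
      · rw [if_neg hse]; split_ifs <;> rfl
    · rw [if_neg hs, coeff_zero, coeff_monomial]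
      by_cases hse : s = e
      · subst hse; rw [if_neg hs]
      · rw [if_neg hse]; split_ifs <;> rfl
  | add p q hp hq =>
    rw [map_add, coeff_add, coeff_add, hp, hq]
    split_ifs <;> simp

/-- A monomial of `keep T G` is a monomial of `G` in the letters of `T`. [plumbing] -/
theorem mem_support_of_keep {T : Finset Letter} {G : YPoly k} {e : Expo} (h : e ∈ (keep T G).support) :
    e ∈ G.support ∧ e.support ⊆ T := by
  rw [MvPolynomial.mem_support_iff, coeff_keep] at h
  by_cases hs : e.support ⊆ T
  · rw [if_pos hs] at h; exact ⟨MvPolynomial.mem_support_iff.mpr h, hs⟩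
  · rw [if_neg hs] at h; exact absurd rfl h

/-- Conversely a monomial of `G` in the letters of `T` is a monomial of `keep T G`. [plumbing] -/
theorem mem_support_keep {T : Finset Letter} {G : YPoly k} {e : Expo} (he : e ∈ G.support) (hs : e.support ⊆ T) :
    e ∈ (keep T G).support := by
  rw [MvPolynomial.mem_support_iff, coeff_keep, if_pos hs]; exact MvPolynomial.mem_support_iff.mp he

/-- `keep T G ≠ 0` as soon as `G` has a monomial in the letters of `T`. [plumbing] -/
theorem keep_ne_zero {T : Finset Letter} {G : YPoly k} {e : Expo} (he : e ∈ G.support) (hs : e.support ⊆ T) : keep T G ≠ 0 :=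
  MvPolynomial.ne_zero_iff.mpr ⟨e, MvPolynomial.mem_support_iff.mp (mem_support_keep he hs)⟩

/-- If every monomial of `G` only involves letters of `T`, `keep T G = G`. [plumbing] -/
theorem keep_eq_self {T : Finset Letter} {G : YPoly k} (h : ∀ e ∈ G.support, e.support ⊆ T) : keep T G = G := by
  ext e
  rw [coeff_keep]
  split_ifs with hs
  · rfl
  · by_contra hne
    exact hs (h e (MvPolynomial.mem_support_iff.mpr (Ne.symm hne)))

/-- KILLING COMMUTES WITH TRANSLATING when the translation vanishes on the killed letters. [OURS · L1 W4.5a] -/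
theorem keep_translate (T : Finset Letter) (c : Letter → k) (hc : ∀ m, m ∉ T → c m = 0) (G : YPoly k) :
    keep T (translate c G) = translate c (keep T G) := by
  have h : (keep T).comp (translate c) = (translate (k := k) c).comp (keep T) := by
    apply algHom_ext; intro m
    rw [AlgHom.comp_apply, AlgHom.comp_apply, translate_X, map_add, keep_X, keep_C]
    by_cases hm : m ∈ T
    · rw [if_pos hm, translate_X]
    · rw [if_neg hm, hc m hm, C_0, add_zero, map_zero]
  exact DFunLike.congr_fun h G

/-! ## 3. Orders, degrees, units -/

/-- An exponent of total degree `0` is `0`. [plumbing] -/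
theorem eq_zero_of_tdeg_eq_zero {x : Expo} (h : tdeg x = 0) : x = 0 := by
  unfold tdeg at h
  ext i
  exact (Finset.sum_eq_zero_iff.mp h) i (Finset.mem_univ i)

/-- `tdeg` is Mathlib's degree `e.sum (fun _ n ↦ n)`. [plumbing] -/
theorem tdeg_eq_sum (e : Expo) : tdeg e = e.sum fun _ n => n := by
  unfold tdeg; rw [Finsupp.sum_fintype]; intro; rfl

/-- MULTIPLYING BY A POLYNOMIAL WITH NON-ZERO CONSTANT TERM DOES NOT RAISE THE ORDER: `U(0) ≠ 0`, `ord₀ H ≤ m ⇒ ord₀ (U·H) ≤ m` (the lowest monomial of `H`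
survives with coefficient `U(0)·H_e`). [OURS · L1 W4.5a; folklore] -/
theorem ordLE_unit_mul {U H : YPoly k} (hU : constantCoeff U ≠ 0) {m : ℕ} (hH : OrdLE H m) : OrdLE (U * H) m := by
  classical
  obtain ⟨e, he, hem⟩ := hH
  obtain ⟨e₀, he₀, hmin⟩ := Finset.exists_min_image H.support tdeg ⟨e, he⟩
  refine ⟨e₀, ?_, (hmin e he).trans hem⟩
  rw [MvPolynomial.mem_support_iff, coeff_mul, Finset.sum_eq_single (0, e₀)]
  · rw [← constantCoeff_eq]; exact mul_ne_zero hU (MvPolynomial.mem_support_iff.mp he₀)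
  · intro p hp hne
    rw [Finset.HasAntidiagonal.mem_antidiagonal] at hp
    have hp1 : p.1 ≠ 0 := by
      intro h1; apply hne
      have h2 : p.2 = e₀ := by rw [← hp, h1, zero_add]
      exact Prod.ext h1 h2
    have hlt : tdeg p.2 < tdeg e₀ := by
      rw [← hp, tdeg_add]
      have : tdeg p.1 ≠ 0 := fun h0 => hp1 (eq_zero_of_tdeg_eq_zero h0)
      omega
    have : coeff p.2 H = 0 := by
      by_contra hc
      exact absurd (hmin p.2 (MvPolynomial.mem_support_iff.mpr hc)) (not_le.mpr hlt)
    rw [this, mul_zero]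
  · intro h; exact absurd (Finset.HasAntidiagonal.mem_antidiagonal.mpr (zero_add e₀)) h

/-- `y_m + c` has total degree `≤ 1`. [plumbing] -/
theorem totalDegree_X_add_C_le (m : Letter) (r : k) : ((X m : YPoly k) + C r).totalDegree ≤ 1 :=
  (totalDegree_add _ _).trans (max_le (totalDegree_X (R := k) m).le (by rw [totalDegree_C]; exact Nat.zero_le _))

/-- TRANSLATION DOES NOT RAISE THE TOTAL DEGREE. [OURS · L1 W4.5a; folklore] -/
theorem totalDegree_translate_le (c : Letter → k) (G : YPoly k) : (translate c G).totalDegree ≤ G.totalDegree := by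
  classical
  conv_lhs => rw [G.as_sum, map_sum]
  refine (totalDegree_finsetSum _ _).trans (Finset.sup_le fun s hs => ?_)
  rw [translate_monomial]
  refine (totalDegree_mul _ _).trans ?_
  rw [totalDegree_C, zero_add]
  refine (totalDegree_finsetProd _ _).trans ?_
  refine le_trans (Finset.sum_le_sum fun i _ =>
    (totalDegree_pow _ _).trans (Nat.mul_le_mul_left _ (totalDegree_X_add_C_le i (c i)))) ?_
  simp only [mul_one]
  exact le_totalDegree hs

/-- Every monomial has degree at most the total degree (in the `tdeg` normalisation). [plumbing] -/
theorem tdeg_le_totalDegree {G : YPoly k} {e : Expo} (he : e ∈ G.support) : tdeg e ≤ G.totalDegree := by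
  rw [tdeg_eq_sum]; exact le_totalDegree he

/-- If all monomials of `G` have degree `≤ m`, so does its total degree. [plumbing] -/
theorem totalDegree_le_of_forall {G : YPoly k} {m : ℕ} (h : ∀ e ∈ G.support, tdeg e ≤ m) : G.totalDegree ≤ m := by
  rw [totalDegree]
  exact Finset.sup_le fun s hs => by rw [← tdeg_eq_sum]; exact h s hs

/-- A NON-ZERO POLYNOMIAL OF TOTAL DEGREE `≤ m` HAS ORDER `≤ m` AFTER ANY TRANSLATION. [OURS · L1 W4.5a; folklore] -/
theorem ordLE_translate_of_totalDegree_le {G : YPoly k} (hG : G ≠ 0) {m : ℕ} (hdeg : G.totalDegree ≤ m) (c : Letter → k) :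
    OrdLE (translate c G) m := by
  have hne : translate c G ≠ 0 := fun h => hG (translate_injective c (by rw [h, map_zero]))
  obtain ⟨e, he⟩ := MvPolynomial.ne_zero_iff.mp hne
  exact ⟨e, MvPolynomial.mem_support_iff.mpr he, (tdeg_le_totalDegree (MvPolynomial.mem_support_iff.mpr he)).trans
    ((totalDegree_translate_le c G).trans hdeg)⟩

/-! ## 4. Residual transport under translation -/

/-- THE RESIDUAL DECOMPOSITION IS UNIQUE. [OURS · L1 W4.5a] -/
theorem residual_unique {Exc : Finset Letter} {D : YPoly k} {α β : Expo} {N M : YPoly k}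
    (h₁ : IsResidual Exc D α N) (h₂ : IsResidual Exc D β M) : α = β ∧ N = M := by
  have hαβ : α = β := isResidual_alpha_unique h₁ h₂
  refine ⟨hαβ, ?_⟩
  have h : monomial α (1 : k) * N = monomial α (1 : k) * M := by rw [← h₁.1, hαβ, ← h₂.1]
  exact mul_left_cancel₀ (by rw [Ne, monomial_eq_zero]; exact one_ne_zero) h

/-- ★ RESIDUAL TRANSPORT UNDER TRANSLATION. If `D = y^α·N` is the residual decomposition for the exceptional letters `Exc` at the origin, then at the point `y = c`
(exceptional letters `Exc′ = {n ∈ Exc : c_n = 0}`) the translated `D` has the residual decomposition `y^{α′}·(U·translate c N)` with `α′ = α` on `Exc′` (and `0`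
elsewhere), where `U` (`= ∏_{c_m ≠ 0} (y_m + c_m)^{α_m}`) has NON-ZERO CONSTANT TERM and involves only letters with `c_m ≠ 0` (so it is fixed by every `keep T`
with `c = 0` off `T`). [OURS · L1 W4.5a] -/
theorem isResidual_translate {Exc Exc' : Finset Letter} {D : YPoly k} {α : Expo} {N : YPoly k} (c : Letter → k)
    (h : IsResidual Exc D α N) (hExc' : ∀ n, n ∈ Exc' ↔ n ∈ Exc ∧ c n = 0) :
    ∃ (α' : Expo) (U : YPoly k), IsResidual Exc' (translate c D) α' (U * translate c N) ∧ (∀ n ∈ Exc', α' n = α n) ∧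
      (∀ n, n ∉ Exc' → α' n = 0) ∧ constantCoeff U ≠ 0 ∧ (∀ T : Finset Letter, (∀ m, m ∉ T → c m = 0) → keep T U = U) := by
  classical
  obtain ⟨hD, hαoff, hNres⟩ := h
  -- the surviving exponent and the unit part
  let α' : Expo := α.filter fun m => c m = 0
  let F : Finset Letter := α.support.filter fun m => c m ≠ 0
  let U : YPoly k := ∏ m ∈ F, (X m + C (c m)) ^ α m
  have hα'app : ∀ n, α' n = if c n = 0 then α n else 0 := fun n => Finsupp.filter_apply _ _ n
  -- translate (y^α) = y^{α′} · U
  have hmono : translate c (monomial α (1 : k)) = monomial α' 1 * U := by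
    rw [translate_monomial, C_1, one_mul, ← Finset.prod_filter_mul_prod_filter_not α.support (fun m => c m = 0)]
    congr 1
    · rw [← prod_X_pow_eq_monomial, Finsupp.support_filter]
      refine Finset.prod_congr rfl fun m hm => ?_
      rw [Finset.mem_filter] at hm
      rw [hm.2, C_0, add_zero, hα'app m, if_pos hm.2]
  -- U is fixed by keep T when c = 0 off T, and has non-zero constant term
  have hkeepU : ∀ T : Finset Letter, (∀ m, m ∉ T → c m = 0) → keep T U = U := by
    intro T hT
    rw [map_prod]
    refine Finset.prod_congr rfl fun m hm => ?_
    rw [Finset.mem_filter] at hm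
    have hmT : m ∈ T := by by_contra h'; exact hm.2 (hT m h')
    rw [map_pow, map_add, keep_X, keep_C, if_pos hmT]
  have hU0 : constantCoeff U ≠ 0 := by
    rw [map_prod]
    refine Finset.prod_ne_zero_iff.mpr fun m hm => ?_
    rw [Finset.mem_filter] at hm
    rw [map_pow, map_add, constantCoeff_X, constantCoeff_C, zero_add]
    exact pow_ne_zero _ hm.2
  refine ⟨α', U, ⟨?_, ?_, ?_⟩, ?_, ?_, hU0, hkeepU⟩
  · -- translate D = y^{α′} · (U · translate N)
    rw [hD, map_mul, hmono, mul_assoc]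
  · -- α′ vanishes off Exc′
    intro n hn
    rw [hα'app]
    split_ifs with hc
    · exact hαoff n fun hmem => hn ((hExc' n).mpr ⟨hmem, hc⟩)
    · rfl
  · -- residual witnesses: for n ∈ Exc′ some monomial of U · translate N is free of y_n
    intro n hn
    obtain ⟨hnExc, hcn⟩ := (hExc' n).mp hn
    obtain ⟨e₀, he₀, he₀n⟩ := hNres n hnExc
    let T : Finset Letter := Finset.univ.erase n
    have hT : ∀ m, m ∉ T → c m = 0 := by
      intro m hm
      have : m = n := by simpa [T] using hm
      rw [this, hcn]
    have hsub : ∀ e : Expo, e.support ⊆ T ↔ e n = 0 := by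
      intro e; constructor
      · intro hs; by_contra hne
        have := hs (Finsupp.mem_support_iff.mpr hne); simp [T] at this
      · intro hz m hm
        have : m ≠ n := fun h' => (Finsupp.mem_support_iff.mp hm) (h' ▸ hz)
        simpa [T] using this
    have hK : keep T (U * translate c N) ≠ 0 := by
      rw [map_mul, hkeepU T hT, keep_translate T c hT]
      refine mul_ne_zero (fun h0 => hU0 (by rw [h0, map_zero])) fun h0 => ?_
      exact keep_ne_zero he₀ ((hsub e₀).mpr he₀n) (translate_injective c (by rw [h0, map_zero]))
    obtain ⟨e, he⟩ := MvPolynomial.ne_zero_iff.mp hK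
    obtain ⟨he', hes⟩ := mem_support_of_keep (MvPolynomial.mem_support_iff.mpr he)
    exact ⟨e, he', (hsub e).mp hes⟩
  · intro n hn
    rw [hα'app, if_pos ((hExc' n).mp hn).2]
  · intro n hn
    rw [hα'app]
    split_ifs with hc
    · exact hαoff n fun hmem => hn ((hExc' n).mpr ⟨hmem, hc⟩)
    · rfl

/-! ## 5. The discriminant under translation and re-preparation -/

/-- The discriminant is a polynomial expression: any algebra map transports it. [plumbing] -/
theorem disc_map (φ : YPoly k →ₐ[k] YPoly k) (b₂ b₁ b₀ : YPoly k) : φ (disc b₂ b₁ b₀) = disc (φ b₂) (φ b₁) (φ b₀) := by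
  unfold disc
  simp only [map_sub, map_add, map_mul, map_pow, map_ofNat]

/-- RE-PREPARATION `x ↦ x + t` LEAVES THE DISCRIMINANT UNCHANGED: `(x+t)³ + b₂(x+t)² + b₁(x+t) + b₀ = x³ + (b₂+3t)x² + (b₁+2b₂t+3t²)x + (b₀+b₁t+b₂t²+t³)` has
the same discriminant. [OURS · L1 W4.5a; folklore] -/
theorem disc_xshift (t b₂ b₁ b₀ : YPoly k) :
    disc (b₂ + 3 * t) (b₁ + 2 * b₂ * t + 3 * t ^ 2) (b₀ + b₁ * t + b₂ * t ^ 2 + t ^ 3) = disc b₂ b₁ b₀ := by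
  unfold disc; ring

/-! ## 6. The translation step of a stage and the cap at translated points -/

/-- `S′` IS THE STAGE AT THE POINT `y = c` OF THE CHART OF `S` (after any re-preparation of `x`): its discriminant is the translated one, its exceptional letters are
those of `S` with `c_n = 0`, with the same defects. [OURS · L1 W4.5a · definition] -/
def IsTranslate (S : Stage k) (c : Letter → k) (S' : Stage k) : Prop :=
  S'.D = translate c S.D ∧ (∀ n, n ∈ S'.Exc ↔ n ∈ S.Exc ∧ c n = 0) ∧ ∀ n ∈ S'.Exc, S'.d n = S.d n

/-- How `IsTranslate` arises: translating the coefficients and re-preparing `x ↦ x + t` gives a stage whose discriminant is `translate c S.D`. [OURS · L1 W4.5a] -/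
theorem translate_D_of_coeffs (S S' : Stage k) (c : Letter → k) (t : YPoly k)
    (h₂ : S'.b₂ = translate c S.b₂ + 3 * t) (h₁ : S'.b₁ = translate c S.b₁ + 2 * translate c S.b₂ * t + 3 * t ^ 2)
    (h₀ : S'.b₀ = translate c S.b₀ + translate c S.b₁ * t + translate c S.b₂ * t ^ 2 + t ^ 3) : S'.D = translate c S.D := by
  rw [Stage.D, Stage.D, h₂, h₁, h₀, disc_xshift, disc_map]

/-- ★ NON-POSITIVE SLACKS ARE INHERITED BY EVERY POINT OF THE CHART: if `2d_n ≤ α_n` for all exceptional letters at the origin, then at `y = c` the same holds for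
the surviving letters, for every residual decomposition there. [OURS · L1 W4.5a] -/
theorem allSlackLE_translate {S S' : Stage k} {c : Letter → k} {α : Expo} {N : YPoly k} (htr : IsTranslate S c S')
    (hres : IsResidual S.Exc S.D α N) (hslack : AllSlackLE S α) {α' : Expo} {N' : YPoly k} (hres' : IsResidual S'.Exc S'.D α' N') :
    AllSlackLE S' α' := by
  obtain ⟨hD', hExc', hd'⟩ := htr
  obtain ⟨α₁, U, hres₁, hα₁, -, -, -⟩ := isResidual_translate c hres hExc'
  rw [← hD'] at hres₁
  obtain ⟨hαeq, -⟩ := residual_unique hres₁ hres'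
  subst hαeq
  exact allSlackLE_mono (fun n hn => ((hExc' n).mp hn).1) hd' hα₁ hslack

/-- ★★ THE CAP AT TRANSLATED DROP POINTS: non-positive slacks at the chart origin and the drop-point budget at the point `y = c` force `ρ ≤ 8` there (for every
residual decomposition at `y = c`). With K10f/K10g this bounds the NON-ORIGIN points of the last chart of every high-order / equi-ω chain whose origin has
non-positive slacks (gap (g2) of R26.40, slack branch). [OURS · L1 W4.5a] -/
theorem translate_cap {S S' : Stage k} {c : Letter → k} {α : Expo} {N : YPoly k} (htr : IsTranslate S c S')
    (hres : IsResidual S.Exc S.D α N) (hslack : AllSlackLE S α) (hbud : DropBudget S')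
    {α' : Expo} {N' : YPoly k} (hres' : IsResidual S'.Exc S'.D α' N') : OrdLE N' 8 :=
  ordLE_eight_of_allSlackLE_dropBudget hres' (allSlackLE_translate htr hres hslack hres') hbud

/-- ★★ HIGH-ORDER CHAINS ARE TAME AT EVERY POINT OF THEIR LAST CHART: from an exceptional-free stage through steps with `ν_Z ≥ 2·codim` (K10f `HighOrderReachable`),
every point `y = c` of the current chart carrying the drop-point budget has `ρ ≤ 8`. [OURS · L1 W4.5a] -/
theorem highOrderChain_translate_cap {S₀ S S' : Stage k} {c : Letter → k} (hExc : S₀.Exc = ∅) (hreach : HighOrderReachable S₀ S)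
    (htr : IsTranslate S c S') (hD : S.D ≠ 0) (hbud : DropBudget S')
    {α' : Expo} {N' : YPoly k} (hres' : IsResidual S'.Exc S'.D α' N') : OrdLE N' 8 := by
  obtain ⟨α, N, hres⟩ := LastCentreResidual.exists_isResidual S.Exc S.D hD
  exact translate_cap htr hres (allSlackLE_of_highOrderReachable hExc hreach hres) hbud hres'

end Summit.ResolutionOfSingularities.ResolutionOfSingularities.Theorems.FInjectiveMacaulayfication.LastCentreTranslate

end
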